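import Mathlib
import HarnessLib
import Summits.ValiantsHypothesis.ValiantsHypothesis.Theorems.LacunarySymmetroidMatrixDescartesProductPlusOneWeakMiddle
import Summits.ValiantsHypothesis.ValiantsHypothesis.Theorems.LacunarySymmetroidMatrixDescartesProductPlusOneEulerSectorsTop

/-!
# ValiantsHypothesis / LacunarySymmetroid — crux `MatrixDescartes` (stmt-ValiantsHypothesis-18050, V1),
# LINE (A) «product_plus_one», S4″: the LATE-SWITCHING / WEAK-MIDDLE-LETTER sectors at the TOP coupling (mirror `x ↦ 1/x`)

✓ `…ProductPlusOneLateSwitching` / ✓ `…WeakMiddle` (bottom coupling `l₀ = 0`): a no-dip company whose incoherent rows switch late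
(resp. have a weak middle letter) has `Z₊(eulerNumerator d a 0) ≤ 2m + 1` at EVERY support ratio.  The stub `EulerBoundK3` quantifies over
every coupled letter; this file records the TOP-coupling twins (`l₀ = 2`) by the tree's reversal (✓ `card_pos_roots_euler_le_reverse`,
✓ `eulerNumerator_reverse_top`: support `(0, d₂−d₁, d₂−d₀)`, letters `(a₂, a₁, a₀)`):

* ★ `eulerBound_lateSwitchingTop` — no-dip company, ANY support, every row incoherent AT THE TOP (`a_{j2} a_{j1} < 0`) late-switching in the
  mirror sense (`p′ = d₂−d₁`, `q′ = d₂−d₀`: `p′·a₀²·y^{d₁−d₀} < (q′−3p′)·a₁a₀ ⇒ a₀·f̃_j(y) < 0` for the reversed row `f̃_j`) ⇒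
  `Z₊(eulerNumerator d a 2) ≤ 2m + 1`;
* ★ `eulerBound_weakMiddleTop` — coefficient form: `((q′−2p′)·a₁a₀)^{d₁−d₀}·((q′−3p′)·a₁a₀)^{d₂−d₁} ≤ (p′·a₀²)^{d₂−d₁}·(−p′·a₂a₀)^{d₁−d₀}`
  for every top-incoherent row ⇒ `Z₊(eulerNumerator d a 2) ≤ 2m + 1`; `weakMiddleTop_sector_class` — members `c·X^{m d₂} + ∏ f_j` have `≤ 2m + 2`.

HONEST FRAMING: mirror bookkeeping of sector cells; NOT `stub_eulerBoundK3` (the middle coupling and the dip/one-signed rows remain) /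
`OneChangeFloorK3` / `stub_classRowK3` / `stub_polyLaw` / `MatrixDescartes`; `VP ≠ VNP` is NOT proved.  No definitions, no named facts.
-/

set_option linter.dupNamespace false

namespace Summit.ValiantsHypothesis.ValiantsHypothesis.Theorems.LacunarySymmetroidMatrixDescartes

namespace ProductPlusOne

open Polynomial Finset
open scoped BigOperators

/-- ★ **LATE SWITCHING AT THE TOP COUPLING** (`l₀ = 2`, ANY support, no-dip company): hypothesis = the late-switching hypothesis of
✓ `eulerBound_lateSwitching` for the REVERSED rows `a₂ + a₁ y^{d₂−d₁} + a₀ y^{d₂−d₀}` (`y = 1/x`). Then `Z₊(eulerNumerator d a 2) ≤ 2m + 1`.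
[this file's theorem] -/
theorem eulerBound_lateSwitchingTop {m : ℕ} (d : Fin 3 → ℕ) (h01 : d 0 < d 1) (h12 : d 1 < d 2)
    (a : Fin m → Fin 3 → ℝ) (hac : ∀ j, a j 0 * a j 2 < 0)
    (hlate : ∀ j, a j 2 * a j 1 < 0 → ∀ y : ℝ, 0 < y →
      ((d 2 : ℝ) - d 1) * a j 0 ^ 2 * y ^ (d 1 - d 0) < (((d 2 : ℝ) - d 0) - 3 * ((d 2 : ℝ) - d 1)) * (a j 1 * a j 0) →
      a j 0 * (a j 2 + a j 1 * y ^ (d 2 - d 1) + a j 0 * y ^ (d 2 - d 0)) < 0) :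
    ((∑ j, (∑ l, C (a j l * ((d l : ℝ) - d 2)) * X ^ (d l)) * ∏ i ∈ Finset.univ.erase j, (∑ l, C (a i l) * X ^ (d l))
      : ℝ[X]).roots.toFinset.filter (fun t => 0 < t)).card ≤ 2 * m + 1 := by
  classical
  have hD : ∀ l, d l ≤ d 2 := by
    intro l; fin_cases l
    · exact (h01.trans h12).le
    · exact h12.le
    · exact le_rfl
  refine (card_pos_roots_euler_le_reverse d (d 2) hD a 2).trans ?_
  rw [eulerNumerator_reverse_top d a]
  have c1 : (((d 2 - d 1 : ℕ) : ℝ) - ((d 2 - d 2 : ℕ) : ℝ)) = (d 2 : ℝ) - d 1 := by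
    rw [Nat.sub_self, Nat.cast_zero, sub_zero, Nat.cast_sub h12.le]
  have c2 : (((d 2 - d 0 : ℕ) : ℝ) - ((d 2 - d 2 : ℕ) : ℝ)) = (d 2 : ℝ) - d 0 := by
    rw [Nat.sub_self, Nat.cast_zero, sub_zero, Nat.cast_sub (h01.trans h12).le]
  have c3 : (d 2 - d 0) - (d 2 - d 1) = d 1 - d 0 := by omega
  refine eulerBound_lateSwitching _ ?_ ?_ _ (fun j => ?_) (fun j hab y hy hlt => ?_)
  · show d 2 - d 2 < d 2 - d 1
    omega
  · show d 2 - d 1 < d 2 - d 0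
    omega
  · show a j 2 * a j 0 < 0
    rw [mul_comm]; exact hac j
  · change a j 2 * a j 1 < 0 at hab
    change (((d 2 - d 1 : ℕ) : ℝ) - ((d 2 - d 2 : ℕ) : ℝ)) * a j 0 ^ 2 * y ^ ((d 2 - d 0) - (d 2 - d 1))
        < ((((d 2 - d 0 : ℕ) : ℝ) - ((d 2 - d 2 : ℕ) : ℝ)) - 3 * (((d 2 - d 1 : ℕ) : ℝ) - ((d 2 - d 2 : ℕ) : ℝ)))
          * (a j 1 * a j 0) at hlt
    rw [c1, c2, c3] at hlt
    have h := hlate j hab y hy hlt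
    show a j 0 * (∑ l, C ((![a j 2, a j 1, a j 0] : Fin 3 → ℝ) l)
        * X ^ ((![d 2 - d 2, d 2 - d 1, d 2 - d 0] : Fin 3 → ℕ) l) : ℝ[X]).eval y < 0
    simp only [Fin.sum_univ_three, Matrix.cons_val_zero, Matrix.cons_val_one, Matrix.cons_val_two, Matrix.head_cons,
      Matrix.tail_cons, eval_add, eval_mul, eval_C, eval_pow, eval_X, Nat.sub_self, pow_zero, mul_one]
    exact h

/-- ★ **WEAK MIDDLE LETTER AT THE TOP COUPLING** (`l₀ = 2`, ANY support, no-dip company): with `p′ = d₂−d₁`, `q′ = d₂−d₀`, every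
top-incoherent row (`a_{j2} a_{j1} < 0`) satisfying `((q′−2p′)·a₁a₀)^{d₁−d₀}·((q′−3p′)·a₁a₀)^{d₂−d₁} ≤ (p′·a₀²)^{d₂−d₁}·(−p′·a₂a₀)^{d₁−d₀}`
⇒ `Z₊(eulerNumerator d a 2) ≤ 2m + 1`. [this file's theorem] -/
theorem eulerBound_weakMiddleTop {m : ℕ} (d : Fin 3 → ℕ) (h01 : d 0 < d 1) (h12 : d 1 < d 2)
    (a : Fin m → Fin 3 → ℝ) (hac : ∀ j, a j 0 * a j 2 < 0)
    (hweak : ∀ j, a j 2 * a j 1 < 0 →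
      ((((d 2 : ℝ) - d 0) - 2 * ((d 2 : ℝ) - d 1)) * (a j 1 * a j 0)) ^ (d 1 - d 0)
          * ((((d 2 : ℝ) - d 0) - 3 * ((d 2 : ℝ) - d 1)) * (a j 1 * a j 0)) ^ (d 2 - d 1)
        ≤ (((d 2 : ℝ) - d 1) * a j 0 ^ 2) ^ (d 2 - d 1) * (-(((d 2 : ℝ) - d 1) * (a j 2 * a j 0))) ^ (d 1 - d 0)) :
    ((∑ j, (∑ l, C (a j l * ((d l : ℝ) - d 2)) * X ^ (d l)) * ∏ i ∈ Finset.univ.erase j, (∑ l, C (a i l) * X ^ (d l))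
      : ℝ[X]).roots.toFinset.filter (fun t => 0 < t)).card ≤ 2 * m + 1 := by
  classical
  have hD : ∀ l, d l ≤ d 2 := by
    intro l; fin_cases l
    · exact (h01.trans h12).le
    · exact h12.le
    · exact le_rfl
  refine (card_pos_roots_euler_le_reverse d (d 2) hD a 2).trans ?_
  rw [eulerNumerator_reverse_top d a]
  have c1 : (((d 2 - d 1 : ℕ) : ℝ) - ((d 2 - d 2 : ℕ) : ℝ)) = (d 2 : ℝ) - d 1 := by
    rw [Nat.sub_self, Nat.cast_zero, sub_zero, Nat.cast_sub h12.le]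
  have c2 : (((d 2 - d 0 : ℕ) : ℝ) - ((d 2 - d 2 : ℕ) : ℝ)) = (d 2 : ℝ) - d 0 := by
    rw [Nat.sub_self, Nat.cast_zero, sub_zero, Nat.cast_sub (h01.trans h12).le]
  have c3 : (d 2 - d 0) - (d 2 - d 1) = d 1 - d 0 := by omega
  have c4 : (d 2 - d 1) - (d 2 - d 2) = d 2 - d 1 := by omega
  refine eulerBound_weakMiddle _ ?_ ?_ _ (fun j => ?_) (fun j hab => ?_)
  · show d 2 - d 2 < d 2 - d 1
    omega
  · show d 2 - d 1 < d 2 - d 0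
    omega
  · show a j 2 * a j 0 < 0
    rw [mul_comm]; exact hac j
  · change a j 2 * a j 1 < 0 at hab
    show (((((d 2 - d 0 : ℕ) : ℝ) - ((d 2 - d 2 : ℕ) : ℝ)) - 2 * (((d 2 - d 1 : ℕ) : ℝ) - ((d 2 - d 2 : ℕ) : ℝ))) * (a j 1 * a j 0))
          ^ ((d 2 - d 0) - (d 2 - d 1))
        * (((((d 2 - d 0 : ℕ) : ℝ) - ((d 2 - d 2 : ℕ) : ℝ)) - 3 * (((d 2 - d 1 : ℕ) : ℝ) - ((d 2 - d 2 : ℕ) : ℝ))) * (a j 1 * a j 0))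
          ^ ((d 2 - d 1) - (d 2 - d 2))
      ≤ ((((d 2 - d 1 : ℕ) : ℝ) - ((d 2 - d 2 : ℕ) : ℝ)) * a j 0 ^ 2) ^ ((d 2 - d 1) - (d 2 - d 2))
        * (-((((d 2 - d 1 : ℕ) : ℝ) - ((d 2 - d 2 : ℕ) : ℝ)) * (a j 2 * a j 0))) ^ ((d 2 - d 0) - (d 2 - d 1))
    rw [c1, c2, c3, c4]
    exact hweak j hab

/-- **Member count at the top coupling:** `Z₊(c·X^{m d₂} + ∏ f_j) ≤ 2m + 2` on the weak-middle-letter (top) sector. [this file's theorem] -/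
theorem weakMiddleTop_sector_class {m : ℕ} (d : Fin 3 → ℕ) (h01 : d 0 < d 1) (h12 : d 1 < d 2)
    (a : Fin m → Fin 3 → ℝ) (hac : ∀ j, a j 0 * a j 2 < 0)
    (hweak : ∀ j, a j 2 * a j 1 < 0 →
      ((((d 2 : ℝ) - d 0) - 2 * ((d 2 : ℝ) - d 1)) * (a j 1 * a j 0)) ^ (d 1 - d 0)
          * ((((d 2 : ℝ) - d 0) - 3 * ((d 2 : ℝ) - d 1)) * (a j 1 * a j 0)) ^ (d 2 - d 1)
        ≤ (((d 2 : ℝ) - d 1) * a j 0 ^ 2) ^ (d 2 - d 1) * (-(((d 2 : ℝ) - d 1) * (a j 2 * a j 0))) ^ (d 1 - d 0)) (c : ℝ) :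
    ((C c * X ^ (m * d 2) + ∏ j, (∑ l, C (a j l) * X ^ (d l)) : ℝ[X]).roots.toFinset.filter (fun t => 0 < t)).card
      ≤ 2 * m + 2 := by
  have h1 := card_pos_roots_class_le_euler d a 2 c
  have h2 := eulerBound_weakMiddleTop d h01 h12 a hac hweak
  omega

end ProductPlusOne

end Summit.ValiantsHypothesis.ValiantsHypothesis.Theorems.LacunarySymmetroidMatrixDescartes
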